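import Literature.NumberTheory.EllipticCurves.ModularSymbolsOrdinaryMeasures
import Literature.NumberTheory.EllipticCurves.ModularSymbolsControlUnique
import Literature.NumberTheory.Transcendental.PadicBoxPrinciple
import HarnessLib

/-!
# Ordinary eigensymbols are measure-valued, II: the approximating representatives

Continuation of `ModularSymbolsOrdinaryMeasures`.  For a `U_p`-eigenfunction `Φ̂` with values in
`D̂_k = lim 𝔻⁰_k/F^N` and unit eigenvalue `u` (`U_p Φ̂ = u Φ̂`):

* the ITERATED eigen-relation `uⁿ Φ̂ = Σ_{c mod pⁿ} Φ̂|β_{c,n}` (`pow_smul_eq_sum_slash_betaMat`);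
* hence, choosing representatives `v_c ∈ 𝔻⁰` of the `Φ̂(β_c x, β_c y)` at some level `L`, the measure
  `W = u⁻ⁿ Σ_c v_c|β_{c,n} ∈ 𝔻⁰` represents `Φ̂(x, y)` at level `L` (`mk_repW_eq`);
* the level data of `W` on the cells of level `m ≤ n` are EXACTLY those of the measure `μ_{x,y}` of
  `ModularSymbolsOrdinaryMeasures.ordMass` (`repW_apply_of_le`, `ordMass_apply_of_le`): the
  upper-triangular `β_{c,n}` act on measures by push-forward along `z ↦ c + pⁿz`
  (`distρInt_betaMat_apply_of_le`), and a measure is determined on coarse cells by its fine cells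
  (`apply_eq_sum_filter_of_le`).

So `μ_{x,y} − W` kills every cell of level `≤ n` while `W ≡ Φ̂(x,y) (mod F^L)`; letting `n → ∞` (next
brick) identifies `μ_{x,y}` with `Φ̂(x, y)` in `D̂_k`.  Slope-`0` case of the admissibility argument of
Amice–Vélu / Višik (Mazur–Tate–Teitelbaum 1986, §I.11; Greenberg–Stevens 1993, Thm. 1.10).

Brick B3e-S4b-i of the bottom-up plan recorded with the named fact
`greenbergStevens_kitagawa_twoVariable_interpolation_allBranches`.  Everything is proved; no named facts.

## References

* B. Mazur, J. Tate, J. Teitelbaum, Invent. Math. 84 (1986), §I.11. [MazurTateTeitelbaum1986Invent]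
* R. Greenberg, G. Stevens, Invent. Math. 111 (1993), Thm. 1.10. [GreenbergStevens1993]
-/

noncomputable section

open scoped MatrixGroups
open Matrix CongruenceSubgroup

namespace Literature.NumberTheory.EllipticCurves

open ModularForms ModularForms.HidaCohomology

variable {p : ℕ} [Fact p.Prime]

/-! ### The iterated eigen-relation -/

section IterEigen

variable [NeZero p] {N : ℕ}

omit [Fact p.Prime] in
/-- **Re-indexing `Σ_{b mod pⁿ⁺¹} f(b) = Σ_{c mod pⁿ} Σ_{j mod p} f(c + j pⁿ)`** (as naturals `< pⁿ⁺¹`). [folklore] -/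
theorem sum_zmod_pow_succ_eq_sum_sum {M : Type*} [AddCommMonoid M] (n : ℕ) (f : ℕ → M) :
    ∑ b : ZMod (p ^ (n + 1)), f b.val = ∑ c : ZMod (p ^ n), ∑ j : ZMod p, f (c.val + j.val * p ^ n) := by
  rw [← Finset.sum_fiberwise_of_maps_to (s := (Finset.univ : Finset (ZMod (p ^ (n + 1))))) (t := (Finset.univ : Finset (ZMod (p ^ n))))
    (g := fun b => ZMod.castHom (pow_dvd_pow p n.le_succ) (ZMod (p ^ n)) b) (fun _ _ => Finset.mem_univ _)]
  refine Finset.sum_congr rfl fun c _ => ?_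
  rw [sum_fiber_castHom_eq_sum_zmod n c (fun b => f b.val)]
  exact Finset.sum_congr rfl fun j _ => by rw [val_natCast_add_mul_pow]

/-- **The iterated eigen-relation `uⁿ Φ̂ = Σ_{c mod pⁿ} Φ̂|β_{c,n}`** for `U_p Φ̂ = u Φ̂`.
[cite: MazurTateTeitelbaum1986Invent, §I.11] -/
theorem pow_smul_eq_sum_slash_betaMat (hpN : p ∣ N) (u : ℤ_[p]ˣ) {V : Type*} [AddCommGroup V] [Module ℤ_[p] V]
    (A : CoeffActionOn (sigma0Set N) ℤ_[p] V) {Φ : P1Q → P1Q → V} (heig : A.hecke N p Φ = (u : ℤ_[p]) • Φ) (n : ℕ) :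
    (u : ℤ_[p]) ^ n • Φ = ∑ c : ZMod (p ^ n), A.slash (betaMat p n c.val) Φ := by
  induction n with
  | zero =>
    haveI : Subsingleton (ZMod (p ^ 0)) := by rw [pow_zero]; infer_instance
    rw [pow_zero, one_smul, Fintype.sum_subsingleton _ (0 : ZMod (p ^ 0)), ZMod.val_zero, betaMat_zero_zero, A.slash_one,
      LinearMap.id_apply]
  | succ n ih =>
    rw [pow_succ', mul_smul, ih, Finset.smul_sum]
    simp_rw [smul_slash_betaMat_eq_sum u hpN A heig n]
    exact (sum_zmod_pow_succ_eq_sum_sum n fun b => A.slash (betaMat p (n + 1) b) Φ).symm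

end IterEigen

/-! ### Push-forward along `z ↦ c + pⁿ z` and coarse cells -/

section Pushforward

/-- `pⁿ z` reduces to `0` modulo `p^m`, `m ≤ n`. [folklore] -/
theorem toZModPow_pow_mul_eq_zero {m n : ℕ} (hm : m ≤ n) (z : ℤ_[p]) :
    PadicInt.toZModPow m ((p : ℤ_[p]) ^ n * z) = 0 := by
  rw [map_mul, map_pow, map_natCast]
  obtain ⟨d, rfl⟩ := Nat.exists_eq_add_of_le hm
  rw [pow_add, ← Nat.cast_pow, ZMod.natCast_self, zero_mul, zero_mul]

/-- **The `β_{c,n}` act on measures by push-forward along `z ↦ c + pⁿ z`**: on the cells of level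
`m ≤ n`, `(v|β_{c,n})(s + p^m ℤ_p) = [c ≡ s (p^m)] · m₀(v)`. [folklore] -/
theorem distρInt_betaMat_apply_of_le (k : ℕ) {m n : ℕ} (hm : m ≤ n) (c : ℕ) (v : DInt p) (s : ZMod (p ^ m)) :
    (distρInt p k (betaMat p n c) v).1 m s = if ((c : ZMod (p ^ m)) = s) then moment v.1 0 else 0 := by
  have hM := betaMat_mem_sigma0Set (p := p) p n c
  have hent := norm_entries_of_mem_sigma0Set (dvd_refl p) hM
  have ha1 : ‖(1 : ℤ_[p])‖ = 1 := norm_one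
  rw [distρInt_val_eq_weightActD k (dvd_refl p) hM v,
    weightActD_congr k hent.1 hent.2 ha1 norm_zero_lt_one' (by simp) rfl (by simp) rfl, weightActD_apply]
  -- the integrand is constant
  have hmoeb : ∀ z : ℤ_[p], moebius ha1 norm_zero_lt_one' ((betaMat p n c 0 1 : ℤ) : ℤ_[p])
      ((betaMat p n c 1 1 : ℤ) : ℤ_[p]) z = (c : ℤ_[p]) + (p : ℤ_[p]) ^ n * z := by
    intro z
    have h := autFactor_mul_moebius ha1 norm_zero_lt_one' ((betaMat p n c 0 1 : ℤ) : ℤ_[p])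
      ((betaMat p n c 1 1 : ℤ) : ℤ_[p]) z
    rw [zero_mul, add_zero, one_mul] at h
    rw [h]
    simp only [betaMat_apply01, betaMat_apply11, Int.cast_natCast, Int.cast_pow]
  have hind : ∀ z : ℤ_[p], cellInd (𝕜 := ℚ_[p]) m s (moebius ha1 norm_zero_lt_one' ((betaMat p n c 0 1 : ℤ) : ℤ_[p])
      ((betaMat p n c 1 1 : ℤ) : ℤ_[p]) z) * BoundedDistribution.autPow k (1 : ℤ_[p]) 0 z =
      (if ((c : ZMod (p ^ m)) = s) then (1 : ℚ_[p]) else 0) * (z : ℚ_[p]) ^ 0 := by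
    intro z
    rw [hmoeb, cellInd_apply, map_add, toZModPow_pow_mul_eq_zero hm, add_zero, map_natCast, BoundedDistribution.autPow_apply,
      zero_mul, add_zero, one_pow, pow_zero, PadicInt.coe_one, map_one]
  simp_rw [hind]
  change (ProfiniteTower.toBounded (DInt.toDist v).2).integral
      (fun z : ℤ_[p] => (if ((c : ZMod (p ^ m)) = s) then (1 : ℚ_[p]) else 0) * (z : ℚ_[p]) ^ 0) = _
  refine ((ProfiniteTower.toBounded (DInt.toDist v).2).integral_const_mul _ (uniformContinuous_coe_pow 0)).trans ?_
  by_cases hc : ((c : ZMod (p ^ m)) = s)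
  · simp only [hc, if_true, one_mul, moment_def]; rfl
  · simp only [hc, if_false, zero_mul]

/-- **A measure on coarse cells from fine cells**: `μ(s + p^m ℤ_p) = Σ_{c ↦ s, c mod pⁿ} μ(c + pⁿℤ_p)`, `m ≤ n`.
[folklore] -/
theorem apply_eq_sum_filter_of_le {μ : (n : ℕ) → ZMod (p ^ n) → ℚ_[p]} (hμ : μ ∈ (ProfiniteTower.padicInt p).distributions ℚ_[p])
    {m n : ℕ} (hm : m ≤ n) (s : ZMod (p ^ m)) :
    μ m s = ∑ c ∈ Finset.univ.filter (fun c : ZMod (p ^ n) => ZMod.castHom (pow_dvd_pow p hm) (ZMod (p ^ m)) c = s), μ n c := by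
  classical
  have h1 := (ProfiniteTower.toBounded hμ).integral_cellInd (𝕜 := ℚ_[p]) m s
  have hfg : ∀ z : ℤ_[p], cellInd (𝕜 := ℚ_[p]) m s z =
      (fun c : ZMod (p ^ n) => if ZMod.castHom (pow_dvd_pow p hm) (ZMod (p ^ m)) c = s then (1 : ℚ_[p]) else 0)
        ((ProfiniteTower.padicInt p).proj n z) := by
    intro z
    change _ = if ZMod.castHom (pow_dvd_pow p hm) (ZMod (p ^ m)) (PadicInt.toZModPow n z) = s then (1 : ℚ_[p]) else 0
    rw [cellInd_apply, ZMod.castHom_apply, PadicInt.cast_toZModPow m n hm z]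
  rw [(ProfiniteTower.toBounded hμ).integral_eq_sum_of_factorsThrough (m := n)
    (fun c : ZMod (p ^ n) => if ZMod.castHom (pow_dvd_pow p hm) (ZMod (p ^ m)) c = s then (1 : ℚ_[p]) else 0) hfg] at h1
  rw [ProfiniteTower.toBounded_μ] at h1
  rw [← h1, Finset.sum_filter]
  refine Finset.sum_congr rfl fun c _ => ?_
  rw [mul_ite, mul_one, mul_zero]

end Pushforward

/-! ### The representatives `W = u⁻ⁿ Σ_c v_c|β_{c,n}` -/

section RepW

variable [NeZero p] {k N : ℕ} (hpN : p ∣ N) (u : ℤ_[p]ˣ)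

/-- **The approximating representative** `W = u⁻ⁿ Σ_{c mod pⁿ} v_c|β_{c,n} ∈ 𝔻⁰`. [cite: MazurTateTeitelbaum1986Invent, §I.11] -/
def repW (k n : ℕ) (v : ZMod (p ^ n) → DInt p) : DInt p :=
  (((u⁻¹ : ℤ_[p]ˣ) : ℤ_[p]) ^ n) • ∑ c : ZMod (p ^ n), distρInt p k (betaMat p n c.val) (v c)

omit [NeZero p] in
/-- Components of finite sums in `D̂_k`. [folklore] -/
theorem hatD_sum_val {ι : Type*} (s : Finset ι) (f : ι → HatD p k) (L : ℕ) : (∑ i ∈ s, f i).1 L = ∑ i ∈ s, (f i).1 L := by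
  classical
  induction s using Finset.induction_on with
  | empty => rfl
  | insert a s ha ih => rw [Finset.sum_insert ha, Finset.sum_insert ha, ← ih]; rfl

/-- **`W` represents `Φ̂(x, y)` at level `L`** when the `v_c` represent the `Φ̂(β_c x, β_c y)` there.
[cite: MazurTateTeitelbaum1986Invent, §I.11] -/
theorem mk_repW_eq {Φ : P1Q → P1Q → HatD p k} (heig : (hatDist p k N hpN).hecke N p Φ = (u : ℤ_[p]) • Φ) (x y : P1Q) (L n : ℕ)
    (v : ZMod (p ^ n) → DInt p)
    (hv : ∀ c, (Φ (P1Q.act (betaMat p n c.val) x) (P1Q.act (betaMat p n c.val) y)).1 L = Submodule.Quotient.mk (v c)) :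
    (Φ x y).1 L = Submodule.Quotient.mk (repW u k n v) := by
  have hit := congrFun (congrFun (pow_smul_eq_sum_slash_betaMat hpN u (hatDist p k N hpN) heig n) x) y
  rw [Pi.smul_apply, Pi.smul_apply, Finset.sum_apply, Finset.sum_apply] at hit
  have hL : (((u : ℤ_[p]) ^ n • Φ x y).1) L = (∑ c : ZMod (p ^ n), (hatDist p k N hpN).slash (betaMat p n c.val) Φ x y).1 L :=
    congrArg (fun w : HatD p k => w.1 L) hit
  rw [Submodule.coe_smul, Pi.smul_apply, hatD_sum_val] at hL
  have hterm : ∀ c : ZMod (p ^ n), ((hatDist p k N hpN).slash (betaMat p n c.val) Φ x y).1 L =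
      Submodule.Quotient.mk (distρInt p k (betaMat p n c.val) (v c)) := by
    intro c
    rw [CoeffActionOn.slash_apply]
    change (((distCoeffInt p k N hpN).hat (sigma0Set_mulClosed N) (isInvariant_filGInt k N hpN) (filGInt_antitone k)).ρ
      (betaMat p n c.val) _).1 L = _
    rw [(distCoeffInt p k N hpN).hat_ρ_val (sigma0Set_mulClosed N) (isInvariant_filGInt k N hpN) (filGInt_antitone k)
      (betaMat_mem_sigma0Set N n c.val) _ L, hv c,
      (distCoeffInt p k N hpN).quotientρ_mk (isInvariant_filGInt k N hpN L) (betaMat_mem_sigma0Set N n c.val), distCoeffInt_ρ]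
  simp_rw [hterm] at hL
  have hsum : (∑ c : ZMod (p ^ n), (Submodule.Quotient.mk (distρInt p k (betaMat p n c.val) (v c)) : DInt p ⧸ filGInt p k L)) =
      Submodule.Quotient.mk (∑ c : ZMod (p ^ n), distρInt p k (betaMat p n c.val) (v c)) :=
    (map_sum (filGInt p k L).mkQ (fun c : ZMod (p ^ n) => distρInt p k (betaMat p n c.val) (v c)) Finset.univ).symm
  rw [hsum] at hL
  -- divide by `uⁿ`
  have hinv : (((u⁻¹ : ℤ_[p]ˣ) : ℤ_[p]) ^ n) * ((u : ℤ_[p]) ^ n) = 1 := by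
    rw [← mul_pow, Units.inv_mul, one_pow]
  calc (Φ x y).1 L = ((((u⁻¹ : ℤ_[p]ˣ) : ℤ_[p]) ^ n) * ((u : ℤ_[p]) ^ n)) • (Φ x y).1 L := by rw [hinv, one_smul]
    _ = (((u⁻¹ : ℤ_[p]ˣ) : ℤ_[p]) ^ n) • Submodule.Quotient.mk (∑ c : ZMod (p ^ n), distρInt p k (betaMat p n c.val) (v c)) := by
        rw [mul_smul, hL]
    _ = Submodule.Quotient.mk (repW u k n v) := by rw [repW, Submodule.Quotient.mk_smul]

/-- **Level data of `W` on coarse cells**: for `m ≤ n`,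
`W(s + p^m ℤ_p) = u⁻ⁿ Σ_{c ↦ s} m₀(v_c)`. [folklore] -/
theorem repW_apply_of_le (n : ℕ) (v : ZMod (p ^ n) → DInt p) {m : ℕ} (hm : m ≤ n) (s : ZMod (p ^ m)) :
    (repW u k n v).1 m s = (((u⁻¹ : ℤ_[p]ˣ) : ℤ_[p]) : ℚ_[p]) ^ n *
      ∑ c : ZMod (p ^ n), (if ZMod.castHom (pow_dvd_pow p hm) (ZMod (p ^ m)) c = s then moment (v c).1 0 else 0) := by
  haveI : NeZero (p ^ n) := ⟨pow_ne_zero _ (NeZero.ne p)⟩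
  rw [repW, Submodule.coe_smul, Pi.smul_apply, Pi.smul_apply, Submodule.coe_sum, Finset.sum_apply, Finset.sum_apply]
  rw [show ((((u⁻¹ : ℤ_[p]ˣ) : ℤ_[p]) ^ n) • ∑ c : ZMod (p ^ n), (distρInt p k (betaMat p n c.val) (v c)).1 m s) =
      ((((u⁻¹ : ℤ_[p]ˣ) : ℤ_[p]) ^ n : ℤ_[p]) : ℚ_[p]) * ∑ c : ZMod (p ^ n), (distρInt p k (betaMat p n c.val) (v c)).1 m s from
      Algebra.smul_def _ _, PadicInt.coe_pow]
  congr 1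
  refine Finset.sum_congr rfl fun c _ => ?_
  rw [distρInt_betaMat_apply_of_le k hm c.val (v c) s, ZMod.castHom_apply, ZMod.cast_eq_val]

/-- **Level data of `μ_{x,y}` on coarse cells** in the same form: for `m ≤ n`,
`μ_{x,y}(s + p^m ℤ_p) = u⁻ⁿ Σ_{c ↦ s} m₀(v_c)`. [folklore] -/
theorem ordMass_apply_of_le {Φ : P1Q → P1Q → HatD p k} (heig : (hatDist p k N hpN).hecke N p Φ = (u : ℤ_[p]) • Φ) (x y : P1Q)
    (L n : ℕ) (v : ZMod (p ^ n) → DInt p)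
    (hv : ∀ c, (Φ (P1Q.act (betaMat p n c.val) x) (P1Q.act (betaMat p n c.val) y)).1 L = Submodule.Quotient.mk (v c))
    {m : ℕ} (hm : m ≤ n) (s : ZMod (p ^ m)) :
    ordMass hpN u Φ x y m s = (((u⁻¹ : ℤ_[p]ˣ) : ℤ_[p]) : ℚ_[p]) ^ n *
      ∑ c : ZMod (p ^ n), (if ZMod.castHom (pow_dvd_pow p hm) (ZMod (p ^ m)) c = s then moment (v c).1 0 else 0) := by
  rw [apply_eq_sum_filter_of_le (ordMass_mem_distributionsInt hpN u heig x y).1 hm s, Finset.sum_filter, Finset.mul_sum]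
  refine Finset.sum_congr rfl fun c _ => ?_
  split_ifs with h
  · rw [ordMass_apply, CoeffActionOn.slash_apply, hatMoment_zero_ρ_betaMat hpN,
      hatMoment_eq_of_proj (Nat.zero_le k) _ L (v c) (hv c)]
  · rw [mul_zero]

/-- **`μ_{x,y}` and `W` agree on every cell of level `≤ n`.** [cite: MazurTateTeitelbaum1986Invent, §I.11] -/
theorem ordMass_eq_repW_of_le {Φ : P1Q → P1Q → HatD p k} (heig : (hatDist p k N hpN).hecke N p Φ = (u : ℤ_[p]) • Φ) (x y : P1Q)
    (L n : ℕ) (v : ZMod (p ^ n) → DInt p)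
    (hv : ∀ c, (Φ (P1Q.act (betaMat p n c.val) x) (P1Q.act (betaMat p n c.val) y)).1 L = Submodule.Quotient.mk (v c))
    {m : ℕ} (hm : m ≤ n) (s : ZMod (p ^ m)) :
    ordMass hpN u Φ x y m s = (repW u k n v).1 m s := by
  rw [ordMass_apply_of_le hpN u heig x y L n v hv hm s, repW_apply_of_le u n v hm s]

omit [NeZero p] hpN u in
/-- **Representatives exist** (the quotient maps are surjective). [folklore] -/
theorem exists_reps (Φ : P1Q → P1Q → HatD p k) (x y : P1Q) (L n : ℕ) :
    ∃ v : ZMod (p ^ n) → DInt p,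
      ∀ c, (Φ (P1Q.act (betaMat p n c.val) x) (P1Q.act (betaMat p n c.val) y)).1 L = Submodule.Quotient.mk (v c) := by
  choose v hv using fun c : ZMod (p ^ n) =>
    Submodule.Quotient.mk_surjective (filGInt p k L) ((Φ (P1Q.act (betaMat p n c.val) x) (P1Q.act (betaMat p n c.val) y)).1 L)
  exact ⟨v, fun c => (hv c).symm⟩

end RepW

/-! ### Measures vanishing on the cells of level `n` have small moments -/

section SmallMoments

/-- **A measure of norm `≤ 1` vanishing on every cell of level `n` integrates `pⁿ`-slowly-varying
functions to norm `≤ p⁻ⁿ`.** [folklore] -/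
theorem norm_integralFn_le_of_level_eq_zero (ν : DInt p) (n : ℕ) (hν : ∀ c : ZMod (p ^ n), ν.1 n c = 0)
    {g : ℤ_[p] → ℚ_[p]} (hg : UniformContinuous g)
    (hgn : ∀ x y : ℤ_[p], PadicInt.toZModPow n x = PadicInt.toZModPow n y → ‖g x - g y‖ ≤ (p : ℝ) ^ (-(n : ℤ))) :
    ‖(ProfiniteTower.padicInt p).integralFn ν.1 g‖ ≤ (p : ℝ) ^ (-(n : ℤ)) := by
  set D := (ProfiniteTower.padicInt p).toBounded₁ ν.2 with hD
  -- the level-`n` step approximation of `g`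
  set gn : ℤ_[p] → ℚ_[p] := fun x => g ((((ProfiniteTower.padicInt p).proj n x).val : ℕ) : ℤ_[p]) with hgn'
  have hgnu : UniformContinuous gn := uniformContinuous_comp_toZModPow n fun c => g ((c.val : ℕ) : ℤ_[p])
  have hstep : D.integral gn = 0 := by
    rw [hgn', D.integral_eq_sum_of_factorsThrough (m := n) (fun c : ZMod (p ^ n) => g ((c.val : ℕ) : ℤ_[p])) (fun x => rfl)]
    refine Finset.sum_eq_zero fun c _ => ?_
    rw [show D.μ n c = ν.1 n c from rfl, hν c, zero_mul]
  have hdiff : ∀ x, ‖g x - gn x‖ ≤ (p : ℝ) ^ (-(n : ℤ)) := by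
    intro x
    refine hgn x _ ?_
    haveI : NeZero (p ^ n) := ⟨pow_ne_zero _ (Fact.out : p.Prime).ne_zero⟩
    rw [map_natCast, ZMod.natCast_zmod_val]
    rfl
  have hint : (ProfiniteTower.padicInt p).integralFn ν.1 g = D.integral g := rfl
  have hsplit : D.integral g = D.integral (fun x => g x - gn x) + D.integral gn := by
    rw [← D.integral_add (hg.sub hgnu) hgnu]
    congr 1
    funext x
    simp
  rw [hint, hsplit, hstep, add_zero]
  have h := D.norm_integral_le (hg.sub hgnu) (zpow_nonneg (Nat.cast_nonneg p) _) hdiff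
  rwa [show D.bound = 1 from rfl, one_mul] at h

/-- **Moments of a measure of norm `≤ 1` vanishing on the cells of level `n` have norm `≤ p⁻ⁿ`.** [folklore] -/
theorem norm_moment_le_of_level_eq_zero (ν : DInt p) (n : ℕ) (hν : ∀ c : ZMod (p ^ n), ν.1 n c = 0) (i : ℕ) :
    ‖moment ν.1 i‖ ≤ (p : ℝ) ^ (-(n : ℤ)) := by
  rw [moment_def]
  refine norm_integralFn_le_of_level_eq_zero ν n hν (uniformContinuous_coe_pow i) fun x y hxy => ?_
  rw [← PadicInt.coe_pow, ← PadicInt.coe_pow, ← PadicInt.coe_sub, PadicInt.padic_norm_e_of_padicInt]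
  have h := norm_autFactor_pow_sub_pow_le i (0 : ℤ_[p]) 1 x y
  rw [zero_add, zero_add, one_mul, one_mul] at h
  exact h.trans (Literature.NumberTheory.Transcendental.PadicBox.norm_sub_le_of_toZModPow_eq hxy)

/-- An element of `ℚ_p` of norm `≤ p⁻ⁿ` for every `n` is `0`. [folklore] -/
theorem eq_zero_of_forall_norm_le_zpow_neg {x : ℚ_[p]} (h : ∀ n : ℕ, ‖x‖ ≤ (p : ℝ) ^ (-(n : ℤ))) : x = 0 := by
  by_contra hx
  have hxpos : 0 < ‖x‖ := norm_pos_iff.mpr hx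
  have hp1 : (1 : ℝ) < p := by exact_mod_cast (Fact.out : p.Prime).one_lt
  obtain ⟨n, hn⟩ := exists_pow_lt_of_lt_one hxpos (inv_lt_one_of_one_lt₀ hp1)
  have : (p : ℝ) ^ (-(n : ℤ)) = (p : ℝ)⁻¹ ^ n := by rw [_root_.zpow_neg, zpow_natCast, inv_pow]
  exact absurd ((h n).trans_eq this) (not_le.mpr hn)

end SmallMoments

/-! ### The identification `μ_{x,y} = Φ̂(x, y)` and the measure-valued eigensymbol -/

section Identify

variable [NeZero p] {k N : ℕ} (hpN : p ∣ N) (u : ℤ_[p]ˣ)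

/-- **`μ_{x,y} ≡ Φ̂(x,y) (mod F^L)` for every `L`.** [cite: GreenbergStevens1993, Thm. 1.10] -/
theorem ordMeasure_sub_mem_filGInt {Φ : P1Q → P1Q → HatD p k} (heig : (hatDist p k N hpN).hecke N p Φ = (u : ℤ_[p]) • Φ)
    (x y : P1Q) (L : ℕ) (v : DInt p) (hv : (Φ x y).1 L = Submodule.Quotient.mk v) :
    ordMeasure hpN u heig x y - v ∈ filGInt p k L := by
  -- for every `n`, the representative `W_n` and the defect `ν_n = μ - W_n`
  have key : ∀ n : ℕ, ∃ W : DInt p, W - v ∈ filGInt p k L ∧ ∀ i : ℕ, ‖moment (ordMeasure hpN u heig x y - W).1 i‖ ≤ (p : ℝ) ^ (-(n : ℤ)) := by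
    intro n
    obtain ⟨w, hw⟩ := exists_reps (k := k) Φ x y L n
    refine ⟨repW u k n w, ?_, fun i => norm_moment_le_of_level_eq_zero _ n (fun c => ?_) i⟩
    · rw [← Submodule.Quotient.eq, ← mk_repW_eq hpN u heig x y L n w hw, hv]
    · rw [Submodule.coe_sub, Pi.sub_apply, Pi.sub_apply, ordMeasure_val, ordMass_eq_repW_of_le hpN u heig x y L n w hw le_rfl c,
        sub_self]
  refine (mem_filGInt_iff (p := p)).mpr (mem_filG_iff.mpr ⟨(ordMeasure hpN u heig x y - v).2, fun i hi => ?_, fun j hj => ?_⟩)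
  · -- low moments vanish
    refine eq_zero_of_forall_norm_le_zpow_neg fun n => ?_
    obtain ⟨W, hW, hsmall⟩ := key n
    have hsplit : moment (ordMeasure hpN u heig x y - v).1 i =
        moment (ordMeasure hpN u heig x y - W).1 i + moment (W - v).1 i := by
      rw [← momentₗ_apply, ← momentₗ_apply, ← momentₗ_apply, ← map_add, sub_add_sub_cancel]
    rw [hsplit, (mem_filG_iff.mp ((mem_filGInt_iff (p := p)).mp hW)).2.1 i hi, add_zero]
    exact hsmall i
  · -- high moments are small
    obtain ⟨W, hW, hsmall⟩ := key (L + 1)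
    have hsplit : moment (ordMeasure hpN u heig x y - v).1 (k + j) =
        moment (ordMeasure hpN u heig x y - W).1 (k + j) + moment (W - v).1 (k + j) := by
      rw [← momentₗ_apply, ← momentₗ_apply, ← momentₗ_apply, ← map_add, sub_add_sub_cancel]
    rw [hsplit]
    refine (IsUltrametricDist.norm_add_le_max _ _).trans (max_le ((hsmall (k + j)).trans ?_)
      ((mem_filG_iff.mp ((mem_filGInt_iff (p := p)).mp hW)).2.2 j hj))
    have hp1 : (1 : ℝ) ≤ p := by exact_mod_cast (Fact.out : p.Prime).one_lt.le
    exact zpow_le_zpow_right₀ hp1 (by omega)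

/-- **`μ_{x,y}` maps to `Φ̂(x, y)` in `D̂_k`.** [cite: GreenbergStevens1993, Thm. 1.10] -/
theorem toHat_ordMeasure {Φ : P1Q → P1Q → HatD p k} (heig : (hatDist p k N hpN).hecke N p Φ = (u : ℤ_[p]) • Φ) (x y : P1Q) :
    CoeffActionOn.toHat (filGInt_antitone (p := p) k) (ordMeasure hpN u heig x y) = Φ x y := by
  refine Subtype.ext (funext fun L => ?_)
  obtain ⟨v, hv⟩ := Submodule.Quotient.mk_surjective (filGInt p k L) ((Φ x y).1 L)
  rw [CoeffActionOn.toHat_val, ← hv]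
  exact (Submodule.Quotient.eq _).mpr (ordMeasure_sub_mem_filGInt hpN u heig x y L v hv.symm)

omit [NeZero p] hpN u in
/-- `𝔻⁰ → D̂_k` is injective (Greenberg's filtration is separated on measures). [cite: Greenberg2007Lifting, Lemma 2] -/
theorem toHat_DInt_injective (k : ℕ) : Function.Injective (CoeffActionOn.toHat (R := ℤ_[p]) (filGInt_antitone (p := p) k)) := by
  refine CoeffActionOn.toHat_injective _ fun v hv => ?_
  have h := eq_zero_of_forall_mem_filG (k := k) (DInt.toDist v) fun L => (mem_filGInt_iff (p := p)).mp (hv L)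
  refine Subtype.ext ?_
  have h' := congrArg Subtype.val h
  exact h'

variable (k) in
/-- The reduction morphism `𝔻⁰_k → D̂_k` of coefficient systems on `Σ₀(N)`. [folklore] -/
def toHatHomK (N : ℕ) (hpN : p ∣ N) : CoeffActionOn.Hom (distCoeffInt p k N hpN) (hatDist p k N hpN) :=
  (distCoeffInt p k N hpN).toHatHom (sigma0Set_mulClosed N) (isInvariant_filGInt k N hpN) (filGInt_antitone k)

omit [NeZero p] hpN u in
/-- `toHatHomK` on elements. [folklore] -/
@[simp] theorem toHatHomK_apply (N : ℕ) (hpN : p ∣ N) (v : DInt p) :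
    (toHatHomK k N hpN).toLinearMap v = CoeffActionOn.toHat (filGInt_antitone (p := p) k) v := rfl

omit [NeZero p] hpN u in
/-- `toHatHomK` is injective on values. [folklore] -/
theorem toHatHomK_injective (N : ℕ) (hpN : p ∣ N) : Function.Injective (toHatHomK k N hpN).toLinearMap :=
  toHat_DInt_injective k

/-- **The measure-valued function of pairs of cusps** `(x, y) ↦ μ_{x,y}`. [cite: GreenbergStevens1993, Thm. 1.10] -/
def ordSymbFun {Φ : P1Q → P1Q → HatD p k} (heig : (hatDist p k N hpN).hecke N p Φ = (u : ℤ_[p]) • Φ) : P1Q → P1Q → DInt p :=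
  fun x y => ordMeasure hpN u heig x y

/-- It lifts `Φ̂` along `𝔻⁰ → D̂_k`. [folklore] -/
theorem mapFun_ordSymbFun {Φ : P1Q → P1Q → HatD p k} (heig : (hatDist p k N hpN).hecke N p Φ = (u : ℤ_[p]) • Φ) :
    (toHatHomK k N hpN).mapFun (ordSymbFun hpN u heig) = Φ := by
  funext x y
  exact toHat_ordMeasure hpN u heig x y

/-- **Ordinary eigensymbols are measure-valued (Greenberg–Stevens 1993, Thm. 1.10, slope `0`;
Amice–Vélu–Višik).**  Every unit-eigenvalue `U_p`-eigensymbol `Φ̂ ∈ Symb_{Γ₀(N)}(D̂_k)` is the image of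
a unique `U_p`-eigensymbol `Ψ ∈ Symb_{Γ₀(N)}(𝔻⁰_k)` with values in MEASURES: `Ψ(x, y) = μ_{x,y}`.
[cite: GreenbergStevens1993, Thm. 1.10] -/
theorem exists_measureValued_eigensymbol (Φ : (hatDist p k N hpN).Symb (Gamma0 N))
    (heig : (hatDist p k N hpN).hecke N p Φ.1 = (u : ℤ_[p]) • Φ.1) :
    ∃ Ψ : (distCoeffInt p k N hpN).Symb (Gamma0 N),
      (distCoeffInt p k N hpN).hecke N p Ψ.1 = (u : ℤ_[p]) • Ψ.1 ∧ (toHatHomK k N hpN).mapFun Ψ.1 = Φ.1 := by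
  have hinj : Function.Injective (toHatHomK k N hpN).toLinearMap := toHatHomK_injective N hpN
  have hmap := mapFun_ordSymbFun hpN u heig
  -- additivity
  have hadd : ordSymbFun hpN u heig ∈ modSym ℤ_[p] (DInt p) := by
    refine (mem_modSym_iff (R := ℤ_[p])).mpr fun x y z => hinj ?_
    rw [map_add]
    have h := (mem_modSym_iff (R := ℤ_[p])).mp Φ.2.1 x y z
    rw [← hmap] at h
    exact h
  -- invariance
  have hinv : ∀ γ : SL(2, ℤ), γ ∈ Gamma0 N → (distCoeffInt p k N hpN).slash γ (ordSymbFun hpN u heig) = ordSymbFun hpN u heig := by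
    intro γ hγ
    funext x y
    refine hinj ?_
    have h := congrFun (congrFun ((toHatHomK k N hpN).mapFun_slash (coe_mem_sigma0Set' γ hγ) (ordSymbFun hpN u heig)) x) y
    rw [CoeffActionOn.Hom.mapFun_apply] at h
    rw [h, hmap, Φ.2.2 γ hγ]
    exact (congrFun (congrFun hmap x) y).symm
  refine ⟨⟨ordSymbFun hpN u heig, hadd, hinv⟩, ?_, hmap⟩
  -- eigen-property
  change (distCoeffInt p k N hpN).hecke N p (ordSymbFun hpN u heig) = (u : ℤ_[p]) • ordSymbFun hpN u heig
  funext x y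
  refine hinj ?_
  have hβ : ∀ i : HeckeIdx N p, heckeRep p i.1 ∈ sigma0Set N := fun i => heckeRep_mem_sigma0Set Fact.out i
  have h := congrFun (congrFun ((toHatHomK k N hpN).mapFun_hecke hβ (ordSymbFun hpN u heig)) x) y
  rw [CoeffActionOn.Hom.mapFun_apply] at h
  rw [h, hmap, heig, Pi.smul_apply, Pi.smul_apply, Pi.smul_apply, Pi.smul_apply, map_smul, ← congrFun (congrFun hmap x) y]
  rfl

omit [NeZero p] u in
/-- **Uniqueness of the measure-valued lift** (injectivity of `𝔻⁰ → D̂_k`). [folklore] -/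
theorem measureValued_lift_unique (Ψ Ψ' : P1Q → P1Q → DInt p)
    (h : (toHatHomK k N hpN).mapFun Ψ = (toHatHomK k N hpN).mapFun Ψ') : Ψ = Ψ' := by
  funext x y
  exact toHat_DInt_injective k (congrFun (congrFun h x) y)

end Identify

/-! ### The control theorem with measure coefficients -/

section ControlMeasures

variable [NeZero p] (k : ℕ) {N : ℕ} (hpN : p ∣ N) (u : ℤ_[p]ˣ)

/-- **Stevens' control theorem in slope `0` with MEASURE coefficients (Greenberg–Stevens 1993,
Thm. 1.10 for `Γ₀(N)`, `p ∣ N`).**  Let `π : 𝔻⁰_k → L` be a morphism of coefficient systems whose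
kernel is exactly the measures with vanishing moments of order `≤ k` (the specialisation `ρ_k`), and
`φ ∈ Symb_{Γ₀(N)}(L)` an exact `U_p`-eigensymbol with unit eigenvalue `u` whose values lie in the range
of `π`.  Then there is a UNIQUE `U_p`-eigensymbol `Ψ ∈ Symb_{Γ₀(N)}(𝔻⁰_k)` (values in bounded measures
on `ℤ_p`) with `U_p Ψ = u Ψ` and `π ∘ Ψ = φ`. [cite: GreenbergStevens1993, Thm. 1.10] -/
theorem existsUnique_measureValued_eigensymbol_of_exact {L : Type*} [AddCommGroup L] [Module ℤ_[p] L]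
    (B : CoeffActionOn (sigma0Set N) ℤ_[p] L) (π : CoeffActionOn.Hom (distCoeffInt p k N hpN) B)
    (hker : ∀ μ : DInt p, π.toLinearMap μ = 0 → ∀ i ≤ k, moment μ.1 i = 0)
    (hF0 : filGInt p k 0 ≤ LinearMap.ker π.toLinearMap)
    (φ : B.Symb (Gamma0 N)) (hφ : B.hecke N p φ.1 = (u : ℤ_[p]) • φ.1)
    (hrange : ∀ y, φ.1 P1Q.infty y ∈ LinearMap.range π.toLinearMap) :
    ∃! Ψ : (distCoeffInt p k N hpN).Symb (Gamma0 N),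
      (distCoeffInt p k N hpN).hecke N p Ψ.1 = (u : ℤ_[p]) • Ψ.1 ∧ π.mapFun Ψ.1 = φ.1 := by
  have hΓS : ∀ γ : SL(2, ℤ), γ ∈ Gamma0 N → (γ : Matrix (Fin 2) (Fin 2) ℤ) ∈ sigma0Set N := fun γ hγ => coe_mem_sigma0Set' γ hγ
  have hβ : ∀ i : HeckeIdx N p, heckeRep p i.1 ∈ sigma0Set N := fun i => heckeRep_mem_sigma0Set Fact.out i
  -- existence
  obtain ⟨Φ, hΦeig, hΦ0⟩ := exists_hatEigensymbol_of_exact k hpN u B π hker hF0 φ hφ hrange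
  obtain ⟨Ψ, hΨeig, hΨmap⟩ := exists_measureValued_eigensymbol hpN u Φ hΦeig
  have hΨπ : π.mapFun Ψ.1 = φ.1 := by
    funext x y
    rw [CoeffActionOn.Hom.mapFun_apply, ← hΦ0 x y]
    have hc : (Φ.1 x y).1 0 = Submodule.Quotient.mk (Ψ.1 x y) := by
      rw [← hΨmap]; rfl
    rw [hc, Submodule.liftQ_apply]
  refine ⟨Ψ, ⟨hΨeig, hΨπ⟩, fun Ψ' ⟨hΨ'eig, hΨ'π⟩ => ?_⟩
  -- uniqueness: compare the images in `Symb(D̂_k)`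
  have himg : ∀ (Θ : (distCoeffInt p k N hpN).Symb (Gamma0 N)), (distCoeffInt p k N hpN).hecke N p Θ.1 = (u : ℤ_[p]) • Θ.1 →
      (hatDist p k N hpN).hecke N p (CoeffActionOn.mapSymb _ _ (toHatHomK k N hpN) hΓS Θ).1 =
        (u : ℤ_[p]) • (CoeffActionOn.mapSymb _ _ (toHatHomK k N hpN) hΓS Θ).1 := by
    intro Θ hΘ
    rw [CoeffActionOn.coe_mapSymb, ← (toHatHomK k N hpN).mapFun_hecke hβ, hΘ, map_smul]
  have h0 : ∀ x y, ((CoeffActionOn.mapSymb _ _ (toHatHomK k N hpN) hΓS Ψ').1 x y).1 0 =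
      ((CoeffActionOn.mapSymb _ _ (toHatHomK k N hpN) hΓS Ψ).1 x y).1 0 := by
    intro x y
    rw [CoeffActionOn.coe_mapSymb, CoeffActionOn.coe_mapSymb]
    change Submodule.Quotient.mk (Ψ'.1 x y) = Submodule.Quotient.mk (Ψ.1 x y)
    refine (Submodule.Quotient.eq _).mpr ((mem_filGInt_iff (p := p)).mpr (mem_filG_zero_of_moments (Ψ'.1 x y - Ψ.1 x y).2 ?_))
    refine hker _ ?_
    have h1 := congrFun (congrFun hΨ'π x) y
    have h2 := congrFun (congrFun hΨπ x) y
    rw [CoeffActionOn.Hom.mapFun_apply] at h1 h2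
    rw [map_sub, h1, h2, sub_self]
  have heq := hatEigensymbol_unique k hpN u _ _ (himg Ψ' hΨ'eig) (himg Ψ hΨeig) h0
  refine Subtype.ext (measureValued_lift_unique (k := k) hpN Ψ'.1 Ψ.1 ?_)
  have := congrArg (fun Θ : (hatDist p k N hpN).Symb (Gamma0 N) => Θ.1) heq
  simpa only [CoeffActionOn.coe_mapSymb] using this

end ControlMeasures

end Literature.NumberTheory.EllipticCurves

end
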